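/-
Copyright (c) 2026 the pub-hodgecm-mathlib formalisation cell (harness21).  Prover seat hodgecm-mathlib-A-p19 (g28): «S3-ram» seeding wave (LEAD F0P3a-plan (g12)
T11-88∕T11-89; owner F0P3a-p06 (g15)), socket (Lit2) of the fold v7.6 — the OPPOSITE-SIGN v-deep literal, transported into `G′_v` along the wave's one-place frame; 2026-09-02.
-/
import Literature.NumberTheory.Rogawski1990.TypeTwoAnisotropicLiteralRamified              -- (this seat) ★-track: `exists_anisotropicLiteral_ram` (the element `Y ∈ U(σ_w, J₀)`)
import Literature.NumberTheory.Rogawski1990.TypeTwoRamifiedFrameLiteral                    -- ★ p847566 (F0P3a-p03): `finKappaAt_eq_ite_of_onePlace_eigenvector`, `vDeep_of_coe_eq_conj_of_entrywise_le`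
import Literature.NumberTheory.Rogawski1990.UnitFundamentalLemmaFrameOfFormCongr               -- ★ p846897 (F0P3a-p04): the one-place frame `e`, clauses (i)–(iii)
import Literature.NumberTheory.Rogawski1990.UnitFundamentalLemmaNonsplitTwoClassesAssembly    -- ★ p847309 (F0P3a-p03): `isUnit_eval_finCharpolyTwo_of_not_exists_isRoot`
import HarnessLib

/-!
# The type-(2) literal of sign `−(y_λ, θ)_v` at a TAMELY RAMIFIED place: a v-DEEP match in the OTHER class (Rogawski 1990 §4.9 Prop. 4.9.1, §3.5 Prop. 3.5.2 (c);
# Labesse–Langlands 1979 §2)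

Topic `NumberTheory/Rogawski1990`; namespace `Literature.NumberTheory.Rogawski1990`.  THEOREMS ONLY (no definition, no instance, no notation, no named fact, no `sorry`); kernel lane
`--supports stmt-HodgeConjecture-24833`.  Cell `pub/hodgecm-mathlib` (D-0151), crux H413; road «S3-ram», fold `LocalTransferAtOneTameRamified` v7.6 (fold pen F0P3-p02 (g17)), socket
**(Lit2)** `stub_typeTwo_literals_{even,odd}_ram` — its (Opp) half (F0P3a-p03 (g17)'s draft heads reduce both sockets to the frame literal ★ `exists_vDeep_frameLiteral_ram` of sign
`(y_λ,θ)_v` plus ONE opposite-sign v-deep match; this file proves the latter).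
HONEST LABEL: HC_CM is proved only modulo the cell's 2 remaining named inputs (hLiu418 24832, h413 24833) until rung 0 closes; unconditional local algebra, count-neutral.

THE MATHEMATICS.  For a type-(2) `γ_H = (g, u)` at a non-split tamely ramified `w` in the 2-DEEP TUBE (`g_w ≡ 1`, `u_w ≡ 1 (mod ϖ_w²)`, `χ_{g_w}` rootless): ★ `exists_anisotropicLiteral_ram`
gives `Y ∈ U(σ_w, J₀)`, `Y ≡ 1 (mod ϖ²)`, `GL₃`-conjugate to `endoGL(g_w, u_w)`, with a `u_w`-eigenvector `q` of `J₀`-length `η`, a σ-fixed unit which is NOT a norm.  Pull back along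
the wave's frame `e : G′_v ≃ U(σ_w, J₀)(L_w)`, `e(x) = A·x_w·A⁻¹`, `A ∈ GL₃(𝒪_w)`, `H′_w = (−det H′_w)·ᵗσ̄A·J₀·A` (★ p846897): `t₁ := e⁻¹(Y)` has `(t₁)_w = A⁻¹YA` — MATCHED
(clause (iii): matching = conjugacy with the pattern), v-DEEP (★ `vDeep_of_coe_eq_conj_of_entrywise_le`), and its `u_w`-eigenvector `A⁻¹q` has `H′_w`-length `(−det H′_w)·η`
(`length_inv_mulVec_of_frame`); so `κ_v(γ_H, t₁) = [(−det H′_w)·η ∈ N]` (★ `finKappaAt_eq_ite_of_onePlace_eigenvector`) `= −[−det H′_w ∈ N]` (index two: ★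
`exists_norm_mul_nonNorm_iff`, ★ `norm_dichotomy_of_not_norm`) `= −(y_λ, θ)_v` for `ι_w y_λ = −det H′_w` (★ `hilbertSymbol_eq_one_iff_exists_norm_toPlace`).

* §1 `sum_sum_eq_dotProduct_mulVec`, `length_inv_mulVec_of_frame` (`ℓ_{H′_w}(A⁻¹q) = (−det H′_w)·ℓ_{J₀}(q)`), `mul_self_map_eq_one_of_oneByOne_unitary`, `stdForm_antidiagonal_one_over_eq`.
* §2 **`exists_vDeep_oppositeLiteral_ram`** — `∃ t₁ ∈ G′_v`, `IsLocalNormPair γ_H t₁`, v-deep (the socket's clause VERBATIM), `finKappaAt γ_H t₁ = −(y_λ, θ)_v`.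

## References
* [Rogawski1990] J. D. Rogawski, *Automorphic Representations of Unitary Groups in Three Variables*, Ann. of Math. Stud. 123 (1990), §3.5 Prop. 3.5.2 (c) p. 29, §3.6 p. 31,
  §4.3 (4.3.2) p. 43, §4.9 Prop. 4.9.1 p. 55, §14.2 p. 233.
* [LabesseLanglands1979] J.-P. Labesse, R. P. Langlands, *L-indistinguishability for SL(2)*, Canad. J. Math. 31 (1979), §2 pp. 8–10.
* [LanglandsShelstad1987] R. P. Langlands, D. Shelstad, *On the definition of transfer factors*, Math. Ann. 278 (1987), §1.
-/

set_option autoImplicit false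

noncomputable section

open NumberField IsDedekindDomain Matrix Polynomial
open Literature.NumberTheory.Automorphic Literature.NumberTheory.Automorphic.UnitaryGroup Literature.NumberTheory.Automorphic.UnitaryLatticeTree
open Literature.NumberTheory.GaloisRepresentations Literature.NumberTheory.QuadraticForms
open scoped MatrixGroups ValuativeRel

namespace Literature.NumberTheory.Rogawski1990

/-! ## §1 Lengths along the frame -/

/-- The double-sum length is `σ̄q ⬝ (M q)`. [cite: Rogawski1990, §3.5 p. 29] -/
theorem sum_sum_eq_dotProduct_mulVec {K : Type*} [Field K] (σ : K →+* K) (M : Matrix (Fin 3) (Fin 3) K) (q : Fin 3 → K) :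
    (∑ i : Fin 3, ∑ k : Fin 3, σ (q i) * M i k * q k) = (fun i => σ (q i)) ⬝ᵥ (M *ᵥ q) := by
  simp only [dotProduct, Matrix.mulVec, Finset.mul_sum, mul_assoc]

/-- **Transport of lengths along a similitude**: if `ᵗσ̄T·M·T = c·N` then `ℓ_M(T q) = c·ℓ_N(q)` (`ℓ_M(v) = σ̄v ⬝ M v`). [cite: Rogawski1990, §3.5 Prop. 3.5.2 p. 29] -/
theorem dotProduct_mulVec_of_formCongr_eq_smul {K : Type*} [Field K] (σ : K →+* K) {T : Matrix (Fin 3) (Fin 3) K} {M N : Matrix (Fin 3) (Fin 3) K} {c : K}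
    (h : (T.map σ)ᵀ * M * T = c • N) (q : Fin 3 → K) :
    (fun i => σ ((T *ᵥ q) i)) ⬝ᵥ (M *ᵥ (T *ᵥ q)) = c * ((fun i => σ (q i)) ⬝ᵥ (N *ᵥ q)) := by
  have hmap : (fun i => σ ((T *ᵥ q) i)) = T.map σ *ᵥ fun i => σ (q i) := by
    funext i
    simp only [Matrix.mulVec, dotProduct, map_sum, map_mul, Matrix.map_apply]
  rw [hmap, ← Matrix.vecMul_transpose, ← Matrix.dotProduct_mulVec, Matrix.mulVec_mulVec, Matrix.mulVec_mulVec, h, Matrix.smul_mulVec,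
    dotProduct_smul, smul_eq_mul]

section CM

variable (L : Type) [Field L] [NumberField L] [IsCMField L] (H' : Matrix (Fin 3) (Fin 3) L) {v : HeightOneSpectrum (𝓞 ↥(maximalRealSubfield L))}
  (w : PlacesOver L v) (hw : IsCMField.complexConj L • w.1 = w.1)

/-- **`ℓ_{H′_w}(A⁻¹q) = (−det H′_w)·ℓ_{J₀}(q)`** in the wave's frame `H′_w = (−det H′_w)·ᵗσ̄A·J₀·A` (the vector form of ★ `sum_sum_inv_col_one_eq_neg_det_of_frame`).
[cite: Rogawski1990, §3.5 Prop. 3.5.2 p. 29] [cite: Jacobowitz1962, §8] -/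
theorem length_inv_mulVec_of_frame (A : GL (Fin 3) (w.1.adicCompletion L))
    (hframe : placeForm H' w.1 = (-(placeForm H' w.1).det) •
      formCongr (galAdicCompletionMap (L := L) (IsCMField.complexConj L) hw) A ((StdForm.antidiagonal 3).over (w.1.adicCompletion L)))
    (q : Fin 3 → w.1.adicCompletion L) :
    (∑ i : Fin 3, ∑ k : Fin 3, galAdicCompletionMap (L := L) (IsCMField.complexConj L) hw
        ((((A⁻¹ : GL (Fin 3) (w.1.adicCompletion L)) : Matrix (Fin 3) (Fin 3) (w.1.adicCompletion L)) *ᵥ q) i) * placeForm H' w.1 i k *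
        ((((A⁻¹ : GL (Fin 3) (w.1.adicCompletion L)) : Matrix (Fin 3) (Fin 3) (w.1.adicCompletion L)) *ᵥ q) k)) =
      (-(placeForm H' w.1).det) * ∑ i : Fin 3, ∑ k : Fin 3, galAdicCompletionMap (L := L) (IsCMField.complexConj L) hw (q i) *
        (StdForm.antidiagonal 3).over (w.1.adicCompletion L) i k * q k := by
  set σ := galAdicCompletionMap (L := L) (IsCMField.complexConj L) hw with hσ
  have h2 : formCongr σ A⁻¹ (placeForm H' w.1) = (-(placeForm H' w.1).det) • (StdForm.antidiagonal 3).over (w.1.adicCompletion L) := by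
    conv_lhs => rw [hframe]
    rw [show ∀ (c : w.1.adicCompletion L) (M : Matrix (Fin 3) (Fin 3) (w.1.adicCompletion L)), formCongr σ A⁻¹ (c • M) = c • formCongr σ A⁻¹ M from
      fun c M => by simp only [formCongr, Matrix.mul_smul, Matrix.smul_mul], formCongr_inv_formCongr]
  rw [sum_sum_eq_dotProduct_mulVec, sum_sum_eq_dotProduct_mulVec]
  exact dotProduct_mulVec_of_formCongr_eq_smul σ h2 q

/-- From a `1 × 1` unitary relation `ᵗσ̄(a)·(1)·(a) = (1)`: `σa·a = 1`. [cite: Rogawski1990, §4.8 Case (a) p. 53] -/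
theorem mul_self_map_eq_one_of_oneByOne_unitary {K : Type*} [Field K] (σ : K →+* K) {a : K}
    (h : ((!![a] : Matrix (Fin 1) (Fin 1) K).map σ)ᵀ * !![(1 : K)] * !![a] = !![(1 : K)]) : σ a * a = 1 := by
  have e := congrArg (fun M => M 0 0) h
  simpa [Matrix.mul_apply] using e

/-- `Φ₁ = (1)` over `L_w` as a literal. [cite: Rogawski1990, §4.8 Case (a) p. 53] -/
theorem stdForm_antidiagonal_one_over_eq (K : Type*) [Field K] : (StdForm.antidiagonal 1).over K = !![(1 : K)] := by
  ext i j; fin_cases i; fin_cases j; simp [StdForm.over, StdForm.antidiagonal_J_apply]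

/-! ## §2 The opposite-sign v-deep literal -/

include hw in
/-- **THE OPPOSITE-SIGN v-DEEP LITERAL** ((Lit2) second half).  At a tamely ramified non-split `w ∣ v` (`e(w|v) ≠ 1`, `2 ∈ 𝒪_w^×`), with the wave's anti-fixed uniformiser `ϖ`, integral
antidiagonal frame `A ∈ GL₃(𝒪_w)`, `H′_w = (−det H′_w) • ᵗσ̄A·Φ₃·A`, and symbol argument `ι_w y_λ = −det H′_w`: every `γ_H = (g, u)` in the 2-DEEP TUBE (`g_w ≡ 1`, `u_w ≡ 1 (mod ϖ_w²)`)
with rootless `χ_{g_w}` has a MATCH `t₁ ∈ G′_v`, v-DEEP (`(t₁)_w ≡ 1 (mod ι_w ϖ_v)` entrywise), with `κ_v(γ_H, t₁) = −(y_λ, θ)_v` — the class NOT met by the frame literal ★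
`exists_vDeep_frameLiteral_ram`.  (`t₁ = e⁻¹(Y)` for the anisotropic literal `Y` of ★ `exists_anisotropicLiteral_ram`; see the module docstring.)
[cite: Rogawski1990, §4.9 Prop. 4.9.1 p. 55; §3.5 Prop. 3.5.2 (c) p. 29; §4.3 (4.3.2) p. 43] [cite: LabesseLanglands1979, §2 pp. 8–10] [cite: LanglandsShelstad1987, §1] -/
theorem exists_vDeep_oppositeLiteral_ram (hH' : (H'.map (cmConjRingHom L)).transpose = H')
    (he : v.asIdeal.ramificationIdx' w.1.asIdeal ≠ 1) (hH'w : IsUnit (placeForm H' w.1)) (h2 : IsUnit (2 : 𝒪[w.1.adicCompletion L]))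
    (ϖ : w.1.adicCompletion L) (hϖ : Valued.v ϖ = WithZero.exp (-1 : ℤ)) (hσϖ : galAdicCompletionMap (L := L) (IsCMField.complexConj L) hw ϖ = -ϖ)
    (A : GL (Fin 3) (w.1.adicCompletion L)) (hA : A ∈ glInt 3 (w.1.adicCompletion L))
    (hframe : placeForm H' w.1 = (-(placeForm H' w.1).det) •
      formCongr (galAdicCompletionMap (L := L) (IsCMField.complexConj L) hw) A ((StdForm.antidiagonal 3).over (w.1.adicCompletion L)))
    (yl : v.adicCompletion ↥(maximalRealSubfield L)) (hyl : toPlace v w yl = -(placeForm H' w.1).det)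
    (γH : (cmDatum L 2 (Matrix.of fun i j : Fin 2 => if i.val + j.val + 1 = 2 then (1 : L) else 0)).Local v ×
      (cmDatum L 1 (Matrix.of fun i j : Fin 1 => if i.val + j.val + 1 = 1 then (1 : L) else 0)).Local v)
    (hg : ∀ i j : Fin 2, Valued.v ((((γH.1.val : GL (Fin 2) (UnitaryGroup.LocalRing L v)).val.map (Pi.evalRingHom (fun w' : PlacesOver L v => w'.1.adicCompletion L) w)) - 1) i j) ≤ Valued.v (ϖ ^ 2))
    (hu2 : Valued.v (finGammaTwo L v γH w - 1) ≤ Valued.v (ϖ ^ 2))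
    (hirr : ¬ ∃ x : w.1.adicCompletion L, (((γH.1.val : GL (Fin 2) (UnitaryGroup.LocalRing L v)).val.map
        (Pi.evalRingHom (fun w' : PlacesOver L v => w'.1.adicCompletion L) w)).charpoly).IsRoot x) :
    ∃ t₁ : (cmDatum L 3 H').Local v, IsLocalNormPair L H' v γH t₁ ∧
      (∀ a b, Valued.v (((toPlace v w (HeckeCharacter.uniformizer ↥(maximalRealSubfield L) v : v.adicCompletion ↥(maximalRealSubfield L))) ^ 1)⁻¹ * ((((t₁).val : GL (Fin 3) (UnitaryGroup.LocalRing L v)).val.map (Pi.evalRingHom (fun w' : PlacesOver L v => w'.1.adicCompletion L) w)) a b - (1 : Matrix (Fin 3) (Fin 3) (w.1.adicCompletion L)) a b)) ≤ 1) ∧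
      finKappaAt L v H' γH t₁ = -hilbertSymbol (v.adicCompletion ↥(maximalRealSubfield L)) yl
        (algebraMap ↥(maximalRealSubfield L) _ ((cmQuadraticGenerator L : 𝓞 ↥(maximalRealSubfield L)) : ↥(maximalRealSubfield L))) := by
  have hc1 : IsCMField.complexConj L ≠ 1 := IsCMField.complexConj_ne_one L
  haveI : Algebra.IsQuadraticExtension ↥(maximalRealSubfield L) L := IsCMField.isQuadraticExtension L
  set σ := galAdicCompletionMap (L := L) (IsCMField.complexConj L) hw with hσdef
  have h2v : Valued.v (2 : w.1.adicCompletion L) = 1 :=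
    (v_eq_one_iff_valuation_eq_one _).2 ((Valuation.integer.integers (ValuativeRel.valuation (w.1.adicCompletion L))).isUnit_iff_valuation_eq_one.1 h2)
  -- the block `g_w` and the scalar `u_w` in the one-place models
  set g : GL (Fin 2) (w.1.adicCompletion L) := (localNonsplitEquiv (IsCMField.complexConj L)
      (Matrix.of fun i j : Fin 2 => if i.val + j.val + 1 = 2 then (1 : L) else 0) hc1 w hw γH.1).val with hgdef
  set uu : GL (Fin 1) (w.1.adicCompletion L) := (localNonsplitEquiv (IsCMField.complexConj L)
      (Matrix.of fun i j : Fin 1 => if i.val + j.val + 1 = 1 then (1 : L) else 0) hc1 w hw γH.2).val with huudef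
  have hg' : (g : Matrix (Fin 2) (Fin 2) (w.1.adicCompletion L)) =
      ((γH.1.val : GL (Fin 2) (UnitaryGroup.LocalRing L v)).val.map (Pi.evalRingHom (fun w' : PlacesOver L v => w'.1.adicCompletion L) w)) := rfl
  have hu' : (uu : Matrix (Fin 1) (Fin 1) (w.1.adicCompletion L)) 0 0 = finGammaTwo L v γH w := rfl
  have hgU : g ∈ unitaryGroupOfForm σ !![(0 : w.1.adicCompletion L), 1; 1, 0] := by
    have h : ((g : Matrix (Fin 2) (Fin 2) (w.1.adicCompletion L)).map σ)ᵀ *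
        placeForm (Matrix.of fun i j : Fin 2 => if i.val + j.val + 1 = 2 then (1 : L) else 0) w.1 * (g : Matrix (Fin 2) (Fin 2) (w.1.adicCompletion L)) =
        placeForm (Matrix.of fun i j : Fin 2 => if i.val + j.val + 1 = 2 then (1 : L) else 0) w.1 :=
      mem_unitaryGroupOfForm_iff.1
        (localNonsplitEquiv (IsCMField.complexConj L) (Matrix.of fun i j : Fin 2 => if i.val + j.val + 1 = 2 then (1 : L) else 0) hc1 w hw γH.1).2
    rw [placeForm_antidiagOne, stdForm_antidiagonal_two_over_eq] at h
    exact mem_unitaryGroupOfForm_iff.2 h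
  have hA' : ∀ x : w.1.adicCompletion L, (g : Matrix (Fin 2) (Fin 2) (w.1.adicCompletion L)).charpoly.eval x ≠ 0 :=
    fun x hx => hirr ⟨x, by rw [← hg']; exact hx⟩
  have hg2 : ∀ i j, Valued.v (((g : Matrix (Fin 2) (Fin 2) (w.1.adicCompletion L)) - 1) i j) ≤ Valued.v (ϖ ^ 2) := by rw [hg']; exact hg
  have hu1 : σ ((uu : Matrix (Fin 1) (Fin 1) (w.1.adicCompletion L)) 0 0) * (uu : Matrix (Fin 1) (Fin 1) (w.1.adicCompletion L)) 0 0 = 1 := by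
    have h : ((uu : Matrix (Fin 1) (Fin 1) (w.1.adicCompletion L)).map σ)ᵀ *
        placeForm (Matrix.of fun i j : Fin 1 => if i.val + j.val + 1 = 1 then (1 : L) else 0) w.1 * (uu : Matrix (Fin 1) (Fin 1) (w.1.adicCompletion L)) =
        placeForm (Matrix.of fun i j : Fin 1 => if i.val + j.val + 1 = 1 then (1 : L) else 0) w.1 :=
      mem_unitaryGroupOfForm_iff.1
        (localNonsplitEquiv (IsCMField.complexConj L) (Matrix.of fun i j : Fin 1 => if i.val + j.val + 1 = 1 then (1 : L) else 0) hc1 w hw γH.2).2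
    rw [placeForm_antidiagOne, stdForm_antidiagonal_one_over_eq] at h
    have hmat : (uu : Matrix (Fin 1) (Fin 1) (w.1.adicCompletion L)) = !![(uu : Matrix (Fin 1) (Fin 1) (w.1.adicCompletion L)) 0 0] := by
      ext i j; fin_cases i; fin_cases j; rfl
    rw [hmat] at h
    exact mul_self_map_eq_one_of_oneByOne_unitary σ h
  have hu2' : Valued.v ((uu : Matrix (Fin 1) (Fin 1) (w.1.adicCompletion L)) 0 0 - 1) ≤ Valued.v (ϖ ^ 2) := by rw [hu']; exact hu2
  -- the anisotropic literal `Y ∈ U(σ_w, J₀)`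
  obtain ⟨Y, q, η, hYU, hY2, hconj, hYq, hq0, hlen, hση, hvη, hηN⟩ :=
    exists_anisotropicLiteral_ram L w hw he h2v hϖ hσϖ g hgU hA' hg2 uu hu1 hu2'
  -- the frame and the pull-back `t₁ = e⁻¹(Y)`
  obtain ⟨e, hef, -, hmatch⟩ := exists_frame_of_eq_smul_formCongr_antidiagonal L H' w hw hH'w A hA hframe
  have hYU' : Y ∈ unitaryGroupOfForm σ (placeForm (Matrix.of fun i j : Fin 3 => if i.val + j.val + 1 = 3 then (1 : L) else 0) w.1) := by
    rw [placeForm_antidiagOne]; exact hYU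
  obtain ⟨t₁, ht₁def⟩ : ∃ t₁ : (cmDatum L 3 H').Local v, t₁ = e.symm ⟨Y, hYU'⟩ := ⟨_, rfl⟩
  have het : ((e t₁).val : GL (Fin 3) (w.1.adicCompletion L)) = Y := by
    rw [ht₁def, ContinuousMulEquiv.apply_symm_apply]
  have hmat : ((localNonsplitEquiv (IsCMField.complexConj L) H' hc1 w hw t₁ :
      unitaryGroupOfForm σ (placeForm H' w.1)) : GL (Fin 3) (w.1.adicCompletion L)) = A⁻¹ * Y * A := by
    have h := hef t₁
    rw [het] at h
    rw [h, mul_assoc A, inv_mul_cancel_left, inv_mul_cancel_right]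
  -- matched, v-deep
  have ht₁ : IsLocalNormPair L H' v γH t₁ := (hmatch γH t₁).2 (by rw [het]; exact hconj)
  have hY2' : ∀ i j : Fin 3, Valued.v ((Y : Matrix (Fin 3) (Fin 3) (w.1.adicCompletion L)) i j - (1 : Matrix (Fin 3) (Fin 3) (w.1.adicCompletion L)) i j) ≤
      Valued.v (ϖ ^ 2) := fun i j => by rw [← Matrix.sub_apply]; exact hY2 i j
  have hd₁ := vDeep_of_coe_eq_conj_of_entrywise_le L H' w hw he ϖ hϖ A hA Y hY2' hmat
  refine ⟨t₁, ht₁, hd₁, ?_⟩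
  -- the κ-sign: eigenvector `A⁻¹ q` of length `(−det H′_w)·η`
  have hχ : IsUnit ((finCharpolyTwo L v γH).eval (finGammaTwo L v γH)) := isUnit_eval_finCharpolyTwo_of_not_exists_isRoot L w hw γH hirr
  obtain ⟨q₁, hq₁def⟩ : ∃ q₁ : Fin 3 → w.1.adicCompletion L,
      q₁ = ((A⁻¹ : GL (Fin 3) (w.1.adicCompletion L)) : Matrix (Fin 3) (Fin 3) (w.1.adicCompletion L)) *ᵥ q := ⟨_, rfl⟩
  have hAAi : (A : Matrix (Fin 3) (Fin 3) (w.1.adicCompletion L)) * ((A⁻¹ : GL (Fin 3) (w.1.adicCompletion L)) : Matrix (Fin 3) (Fin 3) (w.1.adicCompletion L)) = 1 := by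
    rw [← Units.val_mul, mul_inv_cancel, Units.val_one]
  have hq₁ : (((localNonsplitEquiv (IsCMField.complexConj L) H' hc1 w hw t₁ : unitaryGroupOfForm σ (placeForm H' w.1)) :
      GL (Fin 3) (w.1.adicCompletion L)) : Matrix (Fin 3) (Fin 3) (w.1.adicCompletion L)) *ᵥ q₁ = finGammaTwo L v γH w • q₁ := by
    rw [hmat, hq₁def, Units.val_mul, Units.val_mul, Matrix.mulVec_mulVec, Matrix.mul_assoc, hAAi, Matrix.mul_one, ← Matrix.mulVec_mulVec, hYq, hu',
      Matrix.mulVec_smul]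
  have hq₁0 : q₁ ≠ 0 := by
    intro h0
    apply hq0
    have h : (A : Matrix (Fin 3) (Fin 3) (w.1.adicCompletion L)) *ᵥ q₁ = q := by
      rw [hq₁def, Matrix.mulVec_mulVec, hAAi, Matrix.one_mulVec]
    rw [← h, h0, Matrix.mulVec_zero]
  have hlen₁ : (∑ i : Fin 3, ∑ k : Fin 3, σ (q₁ i) * placeForm H' w.1 i k * q₁ k) = (-(placeForm H' w.1).det) * η := by
    rw [hq₁def, length_inv_mulVec_of_frame L H' w hw A hframe q, hlen]
  have hdet0 : -(placeForm H' w.1).det ≠ 0 := (((Matrix.isUnit_iff_isUnit_det _).1 hH'w).neg).ne_zero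
  have hη0 : η ≠ 0 := fun h0 => by rw [h0, map_zero] at hvη; exact zero_ne_one hvη
  have hlen0 : (∑ i : Fin 3, ∑ k : Fin 3, σ (q₁ i) * placeForm H' w.1 i k * q₁ k) ≠ 0 := by rw [hlen₁]; exact mul_ne_zero hdet0 hη0
  rw [finKappaAt_eq_ite_of_onePlace_eigenvector L H' w hw γH hχ ht₁ hq₁ hq₁0 hlen0, hlen₁]
  -- index two: `(−det H′_w)·η ∈ N ⟺ −det H′_w ∉ N`, and `[−det H′_w ∈ N] = (y_λ, θ)_v`
  have hσdet : σ (-(placeForm H' w.1).det) = -(placeForm H' w.1).det := by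
    have hh := placeForm_hermitian_of_smul_eq (IsCMField.complexConj L) w H' hH' hw
    have hdet := congrArg Matrix.det hh
    rw [Matrix.det_transpose, ← RingHom.mapMatrix_apply, ← RingHom.map_det] at hdet
    rw [map_neg, hdet]
  have hdich := norm_dichotomy_of_not_norm L w hw he h2v hση hηN
  have hflip := exists_norm_mul_nonNorm_iff L w hw hηN hdich hdet0 hσdet
  have hy0 : yl ≠ 0 := fun h0 => hdet0 (by rw [← hyl, h0, map_zero])
  rcases hilbertSymbol_eq_one_or_eq_neg_one yl
      (algebraMap ↥(maximalRealSubfield L) _ ((cmQuadraticGenerator L : 𝓞 ↥(maximalRealSubfield L)) : ↥(maximalRealSubfield L))) with h1 | h1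
  · have hN : ∃ z : w.1.adicCompletion L, σ z * z = -(placeForm H' w.1).det := by
      rw [← hyl]; exact (hilbertSymbol_eq_one_iff_exists_norm_toPlace L v w hw hy0).1 h1
    rw [if_neg (fun h => hflip.1 h hN), h1]
  · have hN : ¬ ∃ z : w.1.adicCompletion L, σ z * z = -(placeForm H' w.1).det := fun hex => by
      have h := (hilbertSymbol_eq_one_iff_exists_norm_toPlace L v w hw hy0).2 (by rw [hyl]; exact hex)
      rw [h] at h1
      exact absurd h1 (by norm_num)
    rw [if_pos (hflip.2 hN), h1, neg_neg]

end CM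

end Literature.NumberTheory.Rogawski1990

end
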